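import Summits.AtomisticToContinuum.BoseEinsteinCondensation.Theses.BECCutLineWeakDisorder
import Summits.AtomisticToContinuum.BoseEinsteinCondensation.Theses.BECClassicalWindow
import Summits.AtomisticToContinuum.BoseEinsteinCondensation.Theses.BECWallDressingTransfer
import Summits.AtomisticToContinuum.BoseEinsteinCondensation.Theses.BECRieszReverseHolder
import Summits.AtomisticToContinuum.BoseEinsteinCondensation.Theorems.BECCutLineWeakDisorderGroundStateRigidityHardCoreOfConnected
import Summits.AtomisticToContinuum.BoseEinsteinCondensation.Theorems.BECCutLineWeakDisorderGroundStateRigidityStubPosOfConnected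
import Summits.AtomisticToContinuum.BoseEinsteinCondensation.Theorems.BECCutLineWeakDisorderGroundStateRigidityLocBdd
import Literature.MathematicalPhysics.QuantumManyBody.BoseGasHardSet
import HarnessLib.Audit

/-!
# Line `zoo-reduction` — ALTERNATIVE skeleton for crux `GroundStateRigidity`
(item stmt-AtomisticToContinuum-9072, shared by 8 routes; strategist seat
planner-cstrat-stmt-AtomisticToContinuum-9072-s2-0, 2026-08-17; registered ADDITIVELY — it does NOT touch the
live line `Sketch` of the lead, whose landed stubs it re-uses by name)

Crux (fixed, by name): `GroundStateRigidity` — for every repulsive finite-range `v` there is `ρ₀ > 0` such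
that for `0 < ρ < ρ₀`, all large `N` and every `η > 0` some `δ > 0` makes any two `δ`-near-minimisers of the
Dirichlet energy in the box of side `(N/ρ)^{1/3}` `η`-close in `L²` up to a constant phase.

## What this line does that no registered line does: it TYPES Stub 22 (the zoo)

Every registered line (`Sketch`, `insertion_floor`, `loose_pricing`, `pinning_exclusion`,
`persistent_confinement`, `permanent_member`) carries the second open kernel `stub_uniquenessKernelZoo`
VERBATIM: "uniqueness at low density for every admissible wall that is NOT a plain hard core with an
essentially bounded tail" — hollow shells `⊤·1_{[R₁,R₂]}`, gap bonds, fat-Cantor walls, thin non-integrable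
walls `|r − r₁|⁻²`, unbounded integrable shoulders and spikes `|r − r₁|^{-1/2}`. As typed it is a
case-zoo, not a lemma: no prover can be seated on it. This line dissolves it over ONE object the tree
already has, the closed set `hardRad v ⊆ [0, R₀]` of hard radii (`Literature/…/BoseGasHardSet`: the radii of
local non-integrability of `v`, on whose spheres every finite-energy wave function vanishes,
`eq_zero_of_dist_mem_hardRad`), by the dichotomy

* (Z1) `v` has NO positive hard radius: then `v(|·|)` is locally integrable on `ℝ³ ∖ {0}` and uniqueness
  holds in EVERY finite-energy box — Perron–Frobenius through integrable spikes on the coincidence-free box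
  (`stub_posCoreIntegrableTail` at `b = 0`, `stub_coincidenceFree`);
* (Z2) `v` has a positive hard radius; let `b = max hardRad v` be the OUTERMOST WALL. Filling everything
  below it is free at low density (`stub_fillBelowWall`: a bonded sector `{some pair < b}` is cut off from
  the rest by the wall `{some pair = b}` on which trial states vanish (`stub_wallCut`), and pays the bond
  penalty `≥ c/b²` (1-D Dirichlet Poincaré of the bonded pair's relative coordinate inside the ball of radius
  `b`, with the ABSOLUTE floor `stub_absoluteFloor` for the other `N − 2` particles) against the two-particle
  insertion window `2 C_I/s² ≪ c/b²` of `stub_cellInsertion` at cell scale `s ~ ρ^{-1/3}`), so `v` and the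
  filled potential `v⁺ = ⊤·1_{(−∞,b]} + v·1_{(b,∞)}` have the same `E₀` and the same ground states; and `v⁺`
  is a PLAIN HARD CORE of radius `b` whose tail has no hard radius, i.e. is locally integrable beyond `b` —
  the landed hard-core machinery of `Sketch` (Stubs 14, 17, 20) with the bounded-tail Perron–Frobenius
  Stub 19 replaced by its integrable-tail version `stub_posCoreIntegrableTail`, on the free region
  `F_b = {all pairs > b}`, connected at `N b³ ≤ c₀ L³` by the SHARED geometric kernel `stub_cubeConnected`
  (Stub 21 verbatim).

So after this line the crux has exactly ONE open kernel, `stub_cubeConnected` at the outermost wall radius,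
plus provable analysis; the case distinction "(a) / hard core / zoo" of the other lines disappears (class (a)
and the essentially bounded class are inside Z1, the essential hard-core class inside Z2).

## Stubs (7; `sorry` only inside `stub_*`; three are shared verbatim with registered lines)

* `stub_cubeConnected` (KERNEL, open geometry; verbatim Stub 21 of `Sketch`, shared).
* `stub_absoluteFloor` (ABS, M; verbatim Stub A of `loose_pricing`, shared).
* `stub_cellInsertion` (INS, L; verbatim Stub C of `loose_pricing`, shared).
* `stub_wallCut` (CUT, M–L): a finite-energy trial state splits, up to `ε` in `L²` and in energy, into two
  `C¹` Dirichlet symmetric pieces supported in `{all pairs > b}` and in `{some pair < b}` (`b ∈ hardRad v`).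
* `stub_fillBelowWall` (FILL, L; takes ABS, INS, CUT as hypotheses): at low density, eventually,
  `E₀(v⁺) = E₀(v)` and `HasUniqueGroundState v⁺ → HasUniqueGroundState v`.
* `stub_posCoreIntegrableTail` (PF, XL): Stub 19 of `Sketch` for a pointwise hard core `(0, b]`, `b ≥ 0`,
  whose tail is integrable on every shell `{b + m ≤ |w|}` — truncation and tube bounds inside.
* `stub_coincidenceFree` (CF, M): the coincidence set is null and the coincidence-free open box is
  label-path-connected (codimension three).

## Composition (sorry-free): `GroundStateRigidity_of`

`shell_lintegral_ne_top` (no hard radius beyond `b` ⇒ shell integrability, from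
`setLIntegral_lt_top_of_isCompact_subset_compl_hardVec`); `uniqueNoWall` (Z1: CF + PF at `b = 0` +
landed Stubs 5a, 5b, 6, 17, 20); `uniqueOuterWall` (Z2: `b = sSup (hardRad v) ∈ hardRad v` by
`isClosed_hardRad`, FILL, then for `v⁺`: Stub 14 vanishing, KERNEL + Stub 17 chains, PF, Stub 20, and FILL
transfers back); `eventualUniqueness` by the dichotomy; `GroundStateRigidity_of` by
`stub_rigidityOfUnique stub_compactness`; read against `BECClassicalWindow`, `BECWallDressingTransfer`,
`BECCutLineWeakDisorder` and `BECRieszReverseHolder` (verbatim-shared decls).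
-/

noncomputable section

open MeasureTheory Filter Metric
open scoped ENNReal NNReal Topology

namespace Summit.AtomisticToContinuum.BoseEinsteinCondensation.Cruxes.GroundStateRigidity.ZooReduction

open Literature.MathematicalPhysics.QuantumManyBody.BoseGas
open Summit.AtomisticToContinuum.BoseEinsteinCondensation.Theses.BECCutLineWeakDisorder
open Summit.AtomisticToContinuum.BoseEinsteinCondensation.Theorems.GroundStateRigidity
open Summit.AtomisticToContinuum.BoseEinsteinCondensation.Theorems.GroundStateRigidity.HardCoreOfConnected

/-! ## Stubs -/

/-- **Stub KERNEL — OPEN (pure discrete geometry): the dilute hard-sphere configuration space in the cube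
is path-connected, with labels** (verbatim Stub 21 of line `Sketch`, shared registration). Here it is used
ONLY at the outermost wall radius `b = max hardRad v` of the potential. True below BBK's first critical
radius and for `N ≤ 2`; OPEN at fixed small density as `N → ∞` (Baryshnikov–Bubenik–Kahle 2014 §6).
[cite: BaryshnikovBubenikKahle2013, §6; ReedSimonIV1978, Thm XIII.48] -/
theorem stub_cubeConnected :
    ∃ c₀ : ℝ, 0 < c₀ ∧ ∀ (N : ℕ) (L b : ℝ), 0 < b → (N : ℝ) * b ^ 3 ≤ c₀ * L ^ 3 →
      ∀ X ∈ {Z : Config N | Z ∈ boxN N L ∧ ∀ i j : Fin N, i ≠ j → b < dist (Z i) (Z j)},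
      ∀ Y ∈ {Z : Config N | Z ∈ boxN N L ∧ ∀ i j : Fin N, i ≠ j → b < dist (Z i) (Z j)},
        JoinedIn {Z : Config N | Z ∈ boxN N L ∧ ∀ i j : Fin N, i ≠ j → b < dist (Z i) (Z j)} X Y := by
  sorry

/-- **Stub ABS — the absolute floor (Bose = Boltzmann for the infimum)** (verbatim Stub A of line
`loose_pricing`, shared registration). For measurable `v ≥ 0` (hard cores allowed) and EVERY `C¹` function
`f` vanishing off the open box — symmetric or not, normalised or not — `E₀(N, L) · ∫|f|² ≤ ∫ (|∇f|² + V|f|²)`: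
symmetrise the DENSITY (`g_ε = √(ε² + ∑_σ |f ∘ σ|²) − ε`, `kineticDensity_sqrtSym_le`), normalise, `ε → 0`.
[cite: LSSY2005, Ch. 2 remark after (2.1); LiebLoss2001, Thm 7.8] -/
theorem stub_absoluteFloor :
    ∀ (N : ℕ) (v : ℝ → ℝ≥0∞) (L : ℝ) (f : Config N → ℂ), Measurable v → ContDiff ℝ 1 f →
      (∀ X, X ∉ boxN N L → f X = 0) →
      groundStateEnergy v N L * ∫⁻ X, (‖f X‖₊ : ℝ≥0∞) ^ 2 ≤
        ∫⁻ X, (kineticDensity f X + interaction v X * (‖f X‖₊ : ℝ≥0∞) ^ 2) := by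
  sorry

/-- **Stub INS — the cell insertion bound** (verbatim Stub C of line `loose_pricing`, shared registration).
There is an absolute `C_I > 0` such that for measurable `v` of range `R₀` (anything, e.g. `⊤`, below `R₀`),
every cell scale `s` with `4 R₀ ≤ s` and `128 (N+1) s³ ≤ L³`: `E₀(N+1, L) ≤ E₀(N, L) + C_I/s²` (pigeonhole-free
cell, unsymmetrised product trial function with `∫ F² dy ≡ 1`, no cross term, ABS absorbs the symmetry).
[cite: LSSY2005, Thm 2.2] -/
theorem stub_cellInsertion :
    ∃ C_I : ℝ, 0 < C_I ∧ ∀ (N : ℕ) (v : ℝ → ℝ≥0∞) (L R₀ s : ℝ), Measurable v → 0 ≤ R₀ →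
      (∀ r : ℝ, R₀ < r → v r = 0) → 0 < s → 4 * R₀ ≤ s →
      128 * ((N : ℝ) + 1) * s ^ 3 ≤ L ^ 3 →
      groundStateEnergy v (N + 1) L ≤ groundStateEnergy v N L + ENNReal.ofReal (C_I / s ^ 2) := by
  sorry

/-- **Stub CUT — splitting a finite-energy trial state across a wall.** Let `b > 0` be a hard radius of the
measurable potential `v` and `Φ` a trial state of finite `v`-energy. For every `ε > 0` there are two `C¹`,
Dirichlet, Bose-symmetric functions `f_U`, `f_B` with `f_U = 0` wherever some pair is at distance `≤ b`,
`f_B = 0` wherever all pairs are at distance `≥ b`, `‖Φ − (f_U + f_B)‖₂² ≤ ε` and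
`𝓔_v[f_U] + 𝓔_v[f_B] ≤ energy v Φ + ε` (`𝓔_v = rawEnergy v`, the unnormalised quadratic form).
Proof: `Φ.ψ` is continuous with finite `rawEnergy`, so it VANISHES on the wall `W = {some pair at distance b}`
(`eq_zero_of_dist_mem_hardRad`). With the landed pair cutoffs of `stub_coreCutoff` (Stub 15a of `Sketch`):
`f_U = χ Φ.ψ` for `χ` vanishing where some pair `≤ b + δ` and `= 1` where all pairs `≥ b + 2δ`, and
`f_B = (1 − χ') Φ.ψ` for `χ'` at radii `b − 2δ < b − δ`; the supports of `χ` and `1 − χ'` are disjoint, so the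
interaction terms add up to at most that of `Φ`, `|∇(χΦ)|² ≤ (1+θ)χ²|∇Φ|² + (1+θ⁻¹)|∇χ|²|Φ|²` (same for
`1 − χ'`), `|∇χ|² ≤ A/δ²` on the layer `{some pair within 2δ of b}`, and the mass of `Φ` in that layer is
`≤ C δ² ×` (kinetic energy of `Φ` in a slightly thicker layer) by the pointwise Poincaré inequality from the
zero ON the wall along the coordinate lines of the cone decomposition (`ennnorm_sq_le_of_zero`,
`lintegral_line_tightCone_le` of `Literature/…/BoseGasHardSetContact`); the layer kinetic energy and the
`L²`-error `‖Φ(χ' − χ)‖₂` tend to `0` with `δ` (`stub_layerKineticVanishing`, dominated convergence); take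
`θ`, then `δ` small. `N`-dependent constants are harmless (fixed `N`). [cite: LSSY2005, proof of Thm 2.4;
Kato1966, VI §1.3 Thm 1.16] -/
theorem stub_wallCut :
    ∀ (N : ℕ) (v : ℝ → ℝ≥0∞) (L b ε : ℝ), Measurable v → 0 < b → b ∈ hardRad v → 0 < ε →
      ∀ Φ : TrialState N L, energy v Φ ≠ ⊤ →
      ∃ fU fB : Config N → ℂ, ContDiff ℝ 1 fU ∧ ContDiff ℝ 1 fB ∧
        (∀ X, X ∉ boxN N L → fU X = 0) ∧ (∀ X, X ∉ boxN N L → fB X = 0) ∧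
        (∀ (σ : Equiv.Perm (Fin N)) (X : Config N), fU (X ∘ σ) = fU X) ∧
        (∀ (σ : Equiv.Perm (Fin N)) (X : Config N), fB (X ∘ σ) = fB X) ∧
        (∀ X : Config N, (∃ i j : Fin N, i ≠ j ∧ dist (X i) (X j) ≤ b) → fU X = 0) ∧
        (∀ X : Config N, (∀ i j : Fin N, i ≠ j → b ≤ dist (X i) (X j)) → fB X = 0) ∧
        ∫⁻ X, (‖Φ.ψ X - (fU X + fB X)‖₊ : ℝ≥0∞) ^ 2 ≤ ENNReal.ofReal ε ∧
        rawEnergy v fU + rawEnergy v fB ≤ energy v Φ + ENNReal.ofReal ε := by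
  sorry

/-- **Stub FILL — filling below a wall is free at low density (bonded exclusion + transfer).** GIVEN ABS,
INS and CUT (as hypotheses): for admissible `v` and a hard radius `b > 0` of `v` there is `ρ_b > 0` such that
for `0 < ρ < ρ_b` and all large `N`, in the box of side `L = (N/ρ)^{1/3}`, the filled potential
`v⁺ = (s ↦ if s ≤ b then ⊤ else v s)` has the same ground-state energy as `v`, and uniqueness of the
closed-form ground state for `v⁺` implies it for `v`. Proof (fixed `N ≥ 2`, `E₀(v) < ⊤` by
`stub_finiteEnergyLowDensity`). (1) BOND PENALTY: a `C¹` Dirichlet `f` of finite `v`-energy with `f = 0`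
where all pairs are `≥ b` satisfies `𝓔_v[f] ≥ (E₀(v, N−2, L) + c/b²)‖f‖²` with an absolute `c > 0`: `f`
vanishes on the wall `{some pair = b}` (finite raw energy), smooth cell cutoffs
`η_P = ∏_{p ∈ P} g⁻(d_p) ∏_{q ∉ P} g⁺(d_q)` (`g⁻ = 1` on `[0, b−δ]`, `0` on `[b,∞)`; `g⁺ = 0` on `[0,b]`, `1` on
`[b+δ,∞)`; at each point at most ONE `η_P ≠ 0`) give `C¹` pieces `η_P f` with
`∑_P 𝓔[η_P f] ≤ (1+θ)𝓔[f] + o_δ(1)` and `∑_P ‖η_P f‖² ≥ ‖f‖² − o_δ(1)` (wall-layer Poincaré as in CUT); for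
the distinguished pair `(i,j) = min P` the `C¹` fibre `r = xᵢ − xⱼ ↦ η_P f` is supported in the open ball
`|r| < b`, so `2∫|∇_r|² ≥ 2λ(b)∫|·|²` (1-D Dirichlet Poincaré in one Cartesian coordinate of `r`,
`λ(b) ≥ π²/(4b²)`), and the `C¹` fibre `X' ↦ η_P f` over the other `N − 2` particles is Dirichlet, so ABS
gives `E₀(v, N−2, L)` per unit mass (drop `½|∇_R|²`, `v(d_{ij})` and the cross interactions, all `≥ 0`;
Tonelli along a measure-preserving relabelling `Fin N ≃ Fin 2 ⊕ Fin (N−2)`). (2) EXCLUSION: if a ground state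
`Ψ` had mass `μ_B > 0` on `B = {some pair < b}`, approximants `Φ_k → Ψ` with `energy → E₀(v,N)` split by CUT
into `f_U^k + f_B^k` with `‖f_B^k‖² → μ_B`, `‖f_U^k‖² → 1 − μ_B`; ABS on `f_U^k` and (1) on `f_B^k` give
`E₀(N) ≥ (1 − μ_B)E₀(N) + μ_B (E₀(N−2) + c/b²)`, i.e. `E₀(N) ≥ E₀(N−2) + c/b²`, contradicting INS twice
(`E₀(N) ≤ E₀(N−2) + 2C_I/s²`) once `s = (128ρ)^{-1/3} ≥ 4R₀` and `2C_I/s² < c/b²` (low density). So every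
ground state of `v` vanishes a.e. on `B`. (3) TRANSFER: `E₀(v) ≤ E₀(v⁺)` and `q̄_v ≤ q̄_{v⁺}` by monotonicity;
conversely CUT applied to approximants of a ground state `Ψ` of `v` (vanishing on `B`) gives `C¹` states
`f_U^k/‖f_U^k‖ → Ψ` supported in `{all pairs > b}`, where `v⁺ = v`, so `E₀(v⁺) ≤ q̄_{v⁺}[Ψ] ≤ E₀(v)`; hence
every ground state of `v` is a ground state of `v⁺`, and uniqueness transfers (existence of a nonnegative
ground state of `v`: `stub_existsNonnegGroundState`). [cite: LSSY2005, Thm 2.2 and proof of Thm 2.4;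
LiebLoss2001, Thm 7.8; ReedSimonIV1978, §XIII.12 Thm XIII.47] -/
theorem stub_fillBelowWall :
    (∀ (N : ℕ) (v : ℝ → ℝ≥0∞) (L : ℝ) (f : Config N → ℂ), Measurable v → ContDiff ℝ 1 f →
      (∀ X, X ∉ boxN N L → f X = 0) →
      groundStateEnergy v N L * ∫⁻ X, (‖f X‖₊ : ℝ≥0∞) ^ 2 ≤
        ∫⁻ X, (kineticDensity f X + interaction v X * (‖f X‖₊ : ℝ≥0∞) ^ 2)) →
    (∃ C_I : ℝ, 0 < C_I ∧ ∀ (N : ℕ) (v : ℝ → ℝ≥0∞) (L R₀ s : ℝ), Measurable v → 0 ≤ R₀ →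
      (∀ r : ℝ, R₀ < r → v r = 0) → 0 < s → 4 * R₀ ≤ s →
      128 * ((N : ℝ) + 1) * s ^ 3 ≤ L ^ 3 →
      groundStateEnergy v (N + 1) L ≤ groundStateEnergy v N L + ENNReal.ofReal (C_I / s ^ 2)) →
    (∀ (N : ℕ) (v : ℝ → ℝ≥0∞) (L b ε : ℝ), Measurable v → 0 < b → b ∈ hardRad v → 0 < ε →
      ∀ Φ : TrialState N L, energy v Φ ≠ ⊤ →
      ∃ fU fB : Config N → ℂ, ContDiff ℝ 1 fU ∧ ContDiff ℝ 1 fB ∧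
        (∀ X, X ∉ boxN N L → fU X = 0) ∧ (∀ X, X ∉ boxN N L → fB X = 0) ∧
        (∀ (σ : Equiv.Perm (Fin N)) (X : Config N), fU (X ∘ σ) = fU X) ∧
        (∀ (σ : Equiv.Perm (Fin N)) (X : Config N), fB (X ∘ σ) = fB X) ∧
        (∀ X : Config N, (∃ i j : Fin N, i ≠ j ∧ dist (X i) (X j) ≤ b) → fU X = 0) ∧
        (∀ X : Config N, (∀ i j : Fin N, i ≠ j → b ≤ dist (X i) (X j)) → fB X = 0) ∧
        ∫⁻ X, (‖Φ.ψ X - (fU X + fB X)‖₊ : ℝ≥0∞) ^ 2 ≤ ENNReal.ofReal ε ∧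
        rawEnergy v fU + rawEnergy v fB ≤ energy v Φ + ENNReal.ofReal ε) →
    ∀ v : ℝ → ℝ≥0∞, IsRepulsiveFiniteRange v → ∀ b : ℝ, 0 < b → b ∈ hardRad v →
      ∃ ρb : ℝ, 0 < ρb ∧ ∀ ρ : ℝ, 0 < ρ → ρ < ρb → ∀ᶠ N : ℕ in atTop,
        groundStateEnergy (fun s => if s ≤ b then ⊤ else v s) N (sideLength ρ N) =
            groundStateEnergy v N (sideLength ρ N) ∧
          (HasUniqueGroundState (fun s => if s ≤ b then ⊤ else v s) N (sideLength ρ N) →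
            HasUniqueGroundState v N (sideLength ρ N)) := by
  sorry

/-- **Stub PF — a.e. positivity of nonnegative ground states on a chain-connected carrier, for a pointwise
hard core `(0, b]` (`b ≥ 0`; none if `b = 0`) whose tail is integrable on every shell `{b + m ≤ |w|}`,
`m > 0`** (Stub 19 of `Sketch` with the bounded tail replaced by an integrable one; the energy-truncation and
tube hypotheses of Stub 19 are proved inside). With `T_n = e^{-H(v ⊓ n)}` (`‖T_n‖ = e^{-E₀(v ⊓ n)}`,
`norm_fkL2_one_eq_exp_neg_groundStateEnergy`) and the landed closed-form Jensen inequality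
`stub_closedJensen`, `‖T_nΨ₀ − e^{-E₀}Ψ₀‖² ≤ e^{-2E₀(v⊓n)} − e^{-2E₀(v)} → 0` needs (α) TRUNCATION
`supₙ E₀(v ⊓ n) = E₀(v)`: for `b > 0` compare with `v_n = ⊤·1_{(0,b]} + (v ⊓ n)·1_{(b,∞)}` (landed
`groundStateEnergy_trunc_iSup_hardCore` for each `n`, after modifying `v_n` at the null radius `0`) and prove
`supₙ E₀(v_n) = E₀(v)` by the landed cut argument of Stubs 15a–15f with the core cutoff moved out to radii
`b + 2s < b + 3s`, amplitude truncation (`stub_truncHigh`: `|g| ≤ B`) making the excess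
`∫ (V − n)₊ |χ g|² ≤ B² N² L^{3N−3} ∫_{b+2s ≤ |w| ≤ R} (v − n)₊ → 0` (dominated convergence on the shell), and
`stub_kineticCauchy`; for `b = 0` the same with the collision cutoffs of `stub_pairCutoff` (Stub 10's proof
plus the one dominated-convergence term). (β) TUBES with integrable tails: along a segment keeping all pairs
`≥ b + 2m`, paths in the coordinate `ε`-tube keep all pairs `≥ b + m`, and the EXPECTED action there is
bounded uniformly in the start point and in `n` by `∑_{pairs} ∫₀¹ sup_y E[t_m(|xᵢ−xⱼ|(B_s))] ds ≤
6 N² (2/c⋆) ‖t_m‖_{L¹(ds)} ∫₀¹ (4πs)^{-1/2} ds` (`t_m = v·1_{[b+m,∞)}`; integrate the one-dimensional Gaussian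
factor of the cone coordinate first, where `|xᵢ − xⱼ|` moves at rate `≥ c⋆`; `‖t_m‖_{L¹} < ∞` from the shell
hypothesis by polar coordinates, `Measure.toSphere`, as in `BoseGasHardSetRadial`), so Jensen on the tube
event (`measure_ratTube_pos`) gives the `n`-uniform lower bound of `stub_localTubeCore`, chained as in
`stub_chainedTube`; (γ) the contradiction of Stub 19 verbatim (`setIntegral_mul_fkReal_comm`, Lindelöf points,
`fkL2_perronFrobenius`). [cite: ReedSimonIV1978, §XIII.12 Thm XIII.44; ChungZhao1995, Thm 2.4;
Simon1982, Thm B.1.1; Kato1966, VI §1.3 Thm 1.16] -/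
theorem stub_posCoreIntegrableTail :
    ∀ (N : ℕ) (v : ℝ → ℝ≥0∞) (L b : ℝ), 1 ≤ N → 0 < L → 0 ≤ b → Measurable v →
      (∀ s : ℝ, 0 < s → s ≤ b → v s = ⊤) →
      (∀ m : ℝ, 0 < m → ∫⁻ w in {w : Space | b + m ≤ ‖w‖}, v ‖w‖ ≠ ⊤) →
      ∀ S : Set (Config N), MeasurableSet S →
      S ⊆ {Z : Config N | Z ∈ boxN N L ∧ ∀ i j : Fin N, i ≠ j → b < dist (Z i) (Z j)} →
      (∀ X ∈ S, ∀ Y ∈ S, ∃ (k : ℕ) (Z : ℕ → Config N) (m : ℝ), Z 0 = X ∧ Z k = Y ∧ 0 < m ∧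
        (∀ l : ℕ, l ≤ k → Z l ∈ boxN N L) ∧
        ∀ l : ℕ, l < k → ∀ θ : ℝ, θ ∈ Set.Icc (0 : ℝ) 1 → ∀ i j : Fin N, i ≠ j →
          b + 2 * m ≤ ‖(1 - θ) • (Z l i - Z l j) + θ • (Z (l + 1) i - Z (l + 1) j)‖) →
      (∀ Ψ : Config N → ℂ, IsGroundState v L Ψ → ∀ᵐ X : Config N, X ∉ S → Ψ X = 0) →
      ∀ Ψ₀ : Config N → ℝ, (∀ X, 0 ≤ Ψ₀ X) → IsGroundState v L (fun X => (Ψ₀ X : ℂ)) →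
        ∀ᵐ X : Config N, X ∈ S → 0 < Ψ₀ X := by
  sorry

/-- **Stub CF — the coincidence-free box is conull and label-path-connected (codimension three).** For every
`N` and `L > 0`: the coincidence set `{∃ i ≠ j, xᵢ = xⱼ}` is Lebesgue-null (a finite union of proper linear
subspaces of `(ℝ³)^N`, `Measure.addHaar_submodule`), and any two configurations of the open box with all
points distinct are joined by a continuous path of such configurations INSIDE the box: through a generic
intermediate configuration `Z` of the box both straight segments `[X, Z]`, `[Z, Y]` avoid every coincidence
plane (for fixed `X` with distinct points the bad `Z` — some `zᵢ − zⱼ` anti-parallel to `xᵢ − xⱼ` — form a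
null, hence non-full, subset of the box; the box is convex). [folklore] -/
theorem stub_coincidenceFree :
    ∀ (N : ℕ) (L : ℝ), 0 < L →
      volume {Z : Config N | ∃ i j : Fin N, i ≠ j ∧ Z i = Z j} = 0 ∧
      ∀ X ∈ {Z : Config N | Z ∈ boxN N L ∧ ∀ i j : Fin N, i ≠ j → 0 < dist (Z i) (Z j)},
      ∀ Y ∈ {Z : Config N | Z ∈ boxN N L ∧ ∀ i j : Fin N, i ≠ j → 0 < dist (Z i) (Z j)},
        JoinedIn {Z : Config N | Z ∈ boxN N L ∧ ∀ i j : Fin N, i ≠ j → 0 < dist (Z i) (Z j)} X Y := by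
  sorry

/-! ## Assembly (sorry-free glue over the seven stubs and the landed stubs of line `Sketch`) -/

/-- **No hard radius beyond `b` ⇒ the tail is integrable on every shell `{b + m ≤ |w|}`** (`b ≥ 0`,
`m > 0`): the shell up to radius `R > R₀` is compact and disjoint from the hard set
(`mem_hardVec_iff_norm_mem_hardRad`, `setLIntegral_lt_top_of_isCompact_subset_compl_hardVec`), and `v(|w|) = 0`
beyond the range. [folklore] -/
theorem shell_lintegral_ne_top (v : ℝ → ℝ≥0∞) (hv : IsRepulsiveFiniteRange v) (b m : ℝ)
    (hm : 0 < m) (hfree : ∀ r : ℝ, b < r → r ∉ hardRad v) :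
    ∫⁻ w in {w : Space | b + m ≤ ‖w‖}, v ‖w‖ ≠ ⊤ := by
  obtain ⟨R₀, hR₀⟩ := hv.2
  set R : ℝ := max R₀ 0 + 1 with hRdef
  have hRR₀ : R₀ < R := by
    have := le_max_left R₀ 0
    linarith
  -- the integrand vanishes off the closed ball of radius `R`
  have hfun : (fun w : Space => v ‖w‖) =
      (closedBall (0 : Space) R).indicator (fun w : Space => v ‖w‖) := by
    funext w
    by_cases hw : w ∈ closedBall (0 : Space) R
    · rw [Set.indicator_of_mem hw]
    · rw [Set.indicator_of_notMem hw]
      have hw' : R < ‖w‖ := by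
        rw [mem_closedBall, dist_zero_right, not_le] at hw
        exact hw
      exact hR₀ _ (hRR₀.trans hw')
  have hK : IsCompact (closedBall (0 : Space) R ∩ {w : Space | b + m ≤ ‖w‖}) :=
    (isCompact_closedBall (0 : Space) R).inter_right (isClosed_le continuous_const continuous_norm)
  have hKH : closedBall (0 : Space) R ∩ {w : Space | b + m ≤ ‖w‖} ⊆ (hardVec v)ᶜ := by
    intro w hw hwH
    have hbr : b < ‖w‖ := by
      have : b + m ≤ ‖w‖ := hw.2
      linarith
    exact hfree _ hbr (mem_hardVec_iff_norm_mem_hardRad.1 hwH)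
  have heq : ∫⁻ w in {w : Space | b + m ≤ ‖w‖}, v ‖w‖ =
      ∫⁻ w in closedBall (0 : Space) R ∩ {w : Space | b + m ≤ ‖w‖}, v ‖w‖ := by
    calc ∫⁻ w in {w : Space | b + m ≤ ‖w‖}, v ‖w‖
        = ∫⁻ w in {w : Space | b + m ≤ ‖w‖},
            (closedBall (0 : Space) R).indicator (fun w : Space => v ‖w‖) w := by
          rw [← hfun]
      _ = ∫⁻ w in closedBall (0 : Space) R ∩ {w : Space | b + m ≤ ‖w‖}, v ‖w‖ := by
          rw [lintegral_indicator measurableSet_closedBall,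
            Measure.restrict_restrict measurableSet_closedBall]
  rw [heq]
  exact (setLIntegral_lt_top_of_isCompact_subset_compl_hardVec hK hKH).ne

/-- **(Z1) Uniqueness at low density when `v` has no positive hard radius** (integrable spikes, in
particular every `v` essentially locally bounded on `(0, ∞)`): `E₀ < ⊤` eventually (Stub 5a), the carrier
is the coincidence-free box (CF: conull and chain-connected via Stub 17), positivity through spikes is PF at
`b = 0`, uniqueness is Stub 20 fed with Stubs 5b, 6. [cite: ReedSimonIV1978, §XIII.12 Thms XIII.44–47] -/
theorem uniqueNoWall (v : ℝ → ℝ≥0∞) (hv : IsRepulsiveFiniteRange v)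
    (hZ : ∀ r : ℝ, 0 < r → r ∉ hardRad v) :
    ∃ ρ₀ : ℝ, 0 < ρ₀ ∧ ∀ ρ : ℝ, 0 < ρ → ρ < ρ₀ → ∀ᶠ N : ℕ in atTop,
      HasUniqueGroundState v N (sideLength ρ N) := by
  obtain ⟨ρ₁, hρ₁, h₁⟩ := stub_finiteEnergyLowDensity v hv
  refine ⟨ρ₁, hρ₁, fun ρ hρ hρ₁' => ?_⟩
  filter_upwards [h₁ ρ hρ hρ₁', eventually_ge_atTop 1] with N hE hN
  have hL : 0 < sideLength ρ N := sideLength_pos_of_pos hρ hN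
  obtain ⟨hnull, hjoin⟩ := stub_coincidenceFree N (sideLength ρ N) hL
  have hFm : MeasurableSet
      {Z : Config N | Z ∈ boxN N (sideLength ρ N) ∧ ∀ i j : Fin N, i ≠ j → 0 < dist (Z i) (Z j)} :=
    (isOpen_free N (sideLength ρ N) 0).measurableSet
  -- ground states vanish off the coincidence-free box: off the box by the Dirichlet condition, and the
  -- coincidence set is null
  have hvan : ∀ Ψ : Config N → ℂ, IsGroundState v (sideLength ρ N) Ψ → ∀ᵐ X : Config N,
      X ∉ {Z : Config N | Z ∈ boxN N (sideLength ρ N) ∧ ∀ i j : Fin N, i ≠ j → 0 < dist (Z i) (Z j)} →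
        Ψ X = 0 := by
    intro Ψ hΨ
    have hae : ∀ᵐ X : Config N, X ∉ {Z : Config N | ∃ i j : Fin N, i ≠ j ∧ Z i = Z j} :=
      measure_eq_zero_iff_ae_notMem.1 hnull
    filter_upwards [hae] with X hX hXF
    by_cases hbox : X ∈ boxN N (sideLength ρ N)
    · exfalso
      refine hXF ⟨hbox, fun i j hij => ?_⟩
      rcases (dist_nonneg (x := X i) (y := X j)).lt_or_eq with h | h
      · exact h
      · exact absurd ⟨i, j, hij, dist_eq_zero.1 h.symm⟩ hX
    · exact hΨ.eq_zero X hbox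
  refine stub_uniqueOfPosOn stub_lincombGroundState N v (sideLength ρ N) _ hFm
    (stub_existsNonnegGroundState stub_compactness N v (sideLength ρ N) hE) hvan ?_
  intro Ψ₀ hΨ₀ hGS
  refine stub_posCoreIntegrableTail N v (sideLength ρ N) 0 hN hL le_rfl hv.1
    (fun s hs hs0 => absurd hs0 (not_le.2 hs))
    (fun m hm => shell_lintegral_ne_top v hv 0 m hm fun r hr => hZ r (by linarith))
    _ hFm subset_rfl ?_ hvan Ψ₀ hΨ₀ hGS
  intro X hX Y hY
  exact stub_polygonalChain N (sideLength ρ N) 0 X Y (hjoin X hX Y hY)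

/-- **(Z2) Uniqueness at low density when `v` has a positive hard radius**: with the OUTERMOST wall
`b = sSup (hardRad v) ∈ hardRad v` (`isClosed_hardRad`, `le_of_mem_hardRad`), FILL makes the filled potential
`v⁺ = ⊤` on `(−∞, b]`, `= v` beyond, interchangeable with `v` at `ρ < ρ_b` eventually; `v⁺` is a pointwise hard
core whose tail has no hard radius (`shell_lintegral_ne_top`), so on its free region — connected for
`N b³ ≤ c₀ L³` by KERNEL — Stub 14 (vanishing), Stub 17 (chains), PF and Stub 20 give uniqueness for `v⁺`,
and FILL transfers it to `v`. [cite: ReedSimonIV1978, §XIII.12 Thms XIII.44–48] -/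
theorem uniqueOuterWall (v : ℝ → ℝ≥0∞) (hv : IsRepulsiveFiniteRange v)
    (hW : ∃ r : ℝ, 0 < r ∧ r ∈ hardRad v) :
    ∃ ρ₀ : ℝ, 0 < ρ₀ ∧ ∀ ρ : ℝ, 0 < ρ → ρ < ρ₀ → ∀ᶠ N : ℕ in atTop,
      HasUniqueGroundState v N (sideLength ρ N) := by
  obtain ⟨R₀, hR₀⟩ := hv.2
  obtain ⟨r, hr0, hrH⟩ := hW
  -- the outermost wall radius
  have hHne : (hardRad v).Nonempty := ⟨r, hrH⟩
  have hHbdd : BddAbove (hardRad v) := ⟨R₀, fun s hs => le_of_mem_hardRad hR₀ hs⟩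
  obtain ⟨b, hbdef⟩ : ∃ b : ℝ, b = sSup (hardRad v) := ⟨_, rfl⟩
  have hbH : b ∈ hardRad v := by
    rw [hbdef]; exact isClosed_hardRad.csSup_mem hHne hHbdd
  have hb : 0 < b := by
    rw [hbdef]; exact hr0.trans_le (le_csSup hHbdd hrH)
  have hmax : ∀ s : ℝ, b < s → s ∉ hardRad v := by
    intro s hs hsH
    rw [hbdef] at hs
    exact not_le.2 hs (le_csSup hHbdd hsH)
  have hbR₀ : b ≤ R₀ := le_of_mem_hardRad hR₀ hbH
  -- the filled potential `v⁺`
  have hvbm : Measurable (fun s : ℝ => if s ≤ b then (⊤ : ℝ≥0∞) else v s) :=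
    Measurable.ite measurableSet_Iic measurable_const hv.1
  have hcore : ∀ s : ℝ, s ∈ Set.Icc 0 b → (fun s : ℝ => if s ≤ b then (⊤ : ℝ≥0∞) else v s) s = ⊤ := by
    intro s hs
    show (if s ≤ b then (⊤ : ℝ≥0∞) else v s) = ⊤
    rw [if_pos hs.2]
  have hcore' : ∀ s : ℝ, 0 < s → s ≤ b → (fun s : ℝ => if s ≤ b then (⊤ : ℝ≥0∞) else v s) s = ⊤ := by
    intro s _ hs
    show (if s ≤ b then (⊤ : ℝ≥0∞) else v s) = ⊤
    rw [if_pos hs]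
  have htail_eq : ∀ s : ℝ, b < s → (fun s : ℝ => if s ≤ b then (⊤ : ℝ≥0∞) else v s) s = v s := by
    intro s hs
    show (if s ≤ b then (⊤ : ℝ≥0∞) else v s) = v s
    rw [if_neg (not_le.2 hs)]
  -- its tail is integrable on every shell beyond `b`
  have htail : ∀ m : ℝ, 0 < m →
      ∫⁻ w in {w : Space | b + m ≤ ‖w‖}, (fun s : ℝ => if s ≤ b then (⊤ : ℝ≥0∞) else v s) ‖w‖ ≠ ⊤ := by
    intro m hm
    have hS : MeasurableSet {w : Space | b + m ≤ ‖w‖} :=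
      (isClosed_le continuous_const continuous_norm).measurableSet
    have heq : ∫⁻ w in {w : Space | b + m ≤ ‖w‖},
        (fun s : ℝ => if s ≤ b then (⊤ : ℝ≥0∞) else v s) ‖w‖ =
          ∫⁻ w in {w : Space | b + m ≤ ‖w‖}, v ‖w‖ := by
      refine setLIntegral_congr_fun hS ?_
      intro w hw
      have hbw : b < ‖w‖ := by
        have : b + m ≤ ‖w‖ := hw
        linarith
      exact htail_eq _ hbw
    rw [heq]
    exact shell_lintegral_ne_top v hv b m hm hmax
  -- FILL at the wall `b`, the geometric KERNEL, finite energy at low density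
  obtain ⟨ρb, hρb, hfill⟩ := stub_fillBelowWall stub_absoluteFloor stub_cellInsertion stub_wallCut v hv b hb hbH
  obtain ⟨c₀, hc₀, hconn⟩ := stub_cubeConnected
  obtain ⟨ρ₁, hρ₁, h₁⟩ := stub_finiteEnergyLowDensity v hv
  refine ⟨min ρ₁ (min ρb (c₀ / b ^ 3)), lt_min hρ₁ (lt_min hρb (by positivity)), fun ρ hρ hρm => ?_⟩
  have hρ₁' : ρ < ρ₁ := hρm.trans_le (min_le_left _ _)
  have hρb' : ρ < ρb := hρm.trans_le ((min_le_right _ _).trans (min_le_left _ _))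
  have hρc : ρ < c₀ / b ^ 3 := hρm.trans_le ((min_le_right _ _).trans (min_le_right _ _))
  filter_upwards [h₁ ρ hρ hρ₁', hfill ρ hρ hρb', eventually_ge_atTop 1] with N hE hF hN
  obtain ⟨hE0eq, htransfer⟩ := hF
  have hL : 0 < sideLength ρ N := sideLength_pos_of_pos hρ hN
  have hEb : groundStateEnergy (fun s : ℝ => if s ≤ b then (⊤ : ℝ≥0∞) else v s) N (sideLength ρ N) ≠ ⊤ := by
    rw [hE0eq]; exact hE
  -- density: `N b³ ≤ c₀ L³`
  have hdens : (N : ℝ) * b ^ 3 ≤ c₀ * sideLength ρ N ^ 3 := by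
    rw [Negative.sideLength_pow_three hρ (by omega)]
    have hb3 : 0 < b ^ 3 := by positivity
    have h1 : ρ * b ^ 3 ≤ c₀ := by
      rw [lt_div_iff₀ hb3] at hρc
      exact hρc.le
    have hNn : (0 : ℝ) ≤ N := by positivity
    calc (N : ℝ) * b ^ 3 = (N / ρ) * (ρ * b ^ 3) := by field_simp
      _ ≤ (N / ρ) * c₀ := by gcongr
      _ = c₀ * (N / ρ) := by ring
  -- uniqueness for the filled potential on its (connected) free region
  have hFm : MeasurableSet
      {Z : Config N | Z ∈ boxN N (sideLength ρ N) ∧ ∀ i j : Fin N, i ≠ j → b < dist (Z i) (Z j)} :=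
    (isOpen_free N (sideLength ρ N) b).measurableSet
  have hUb : HasUniqueGroundState (fun s : ℝ => if s ≤ b then (⊤ : ℝ≥0∞) else v s) N (sideLength ρ N) := by
    refine stub_uniqueOfPosOn stub_lincombGroundState N _ (sideLength ρ N) _ hFm
      (stub_existsNonnegGroundState stub_compactness N _ (sideLength ρ N) hEb)
      (stub_vanishOffFree N _ (sideLength ρ N) b hb hcore) ?_
    intro Ψ₀ hΨ₀ hGS
    refine stub_posCoreIntegrableTail N _ (sideLength ρ N) b hN hL hb.le hvbm hcore' htail _ hFm
      subset_rfl ?_ (stub_vanishOffFree N _ (sideLength ρ N) b hb hcore) Ψ₀ hΨ₀ hGS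
    intro X hX Y hY
    exact stub_polygonalChain N (sideLength ρ N) b X Y (hconn N (sideLength ρ N) b hb hdens X hX Y hY)
  exact htransfer hUb

/-! ## Composition (sorry-free): the stubs give the crux BY NAME -/

/-- **Eventual uniqueness for every admissible `v`** by the wall dichotomy: no positive hard radius (Z1,
`uniqueNoWall`) or an outermost wall (Z2, `uniqueOuterWall`). [folklore] -/
theorem eventualUniqueness (v : ℝ → ℝ≥0∞) (hv : IsRepulsiveFiniteRange v) :
    ∃ ρ₀ : ℝ, 0 < ρ₀ ∧ ∀ ρ : ℝ, 0 < ρ → ρ < ρ₀ → ∀ᶠ N : ℕ in atTop,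
      HasUniqueGroundState v N (sideLength ρ N) := by
  by_cases hW : ∃ r : ℝ, 0 < r ∧ r ∈ hardRad v
  · exact uniqueOuterWall v hv hW
  · exact uniqueNoWall v hv fun r hr hrH => hW ⟨r, hr, hrH⟩

/-- **`GroundStateRigidity` from the seven registered stubs** (kernel-checked glue, no `sorry` of its
own): eventual uniqueness (above) and rigidity-from-uniqueness (landed Stub 1 fed with Stub 0), read
against the decl of route `BECClassicalWindow` (the skeleton record's `crux_decl`).
[cite: ReedSimonIV1978, §XIII.12] -/
theorem GroundStateRigidity_of :
    Summit.AtomisticToContinuum.BoseEinsteinCondensation.Theses.BECClassicalWindow.GroundStateRigidity := by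
  intro v hv
  obtain ⟨ρ₀, hρ₀, hU⟩ := eventualUniqueness v hv
  refine ⟨ρ₀, hρ₀, fun ρ hρ hρ₀' => ?_⟩
  filter_upwards [hU ρ hρ hρ₀'] with N hN
  intro η hη
  exact stub_rigidityOfUnique stub_compactness v N (sideLength ρ N) hN η hη

/-- The same composition read against the verbatim-shared decl of route `BECWallDressingTransfer` (this
seat's `route_id`; syntactically identical `def`). [cite: ReedSimonIV1978, §XIII.12] -/
theorem GroundStateRigidity_proofWallDressingTransfer :
    Summit.AtomisticToContinuum.BoseEinsteinCondensation.Theses.BECWallDressingTransfer.GroundStateRigidity :=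
  GroundStateRigidity_of

/-- The same composition read against the verbatim-shared decl of route `BECCutLineWeakDisorder` (the
namespace the landed stubs were filed under). [cite: ReedSimonIV1978, §XIII.12] -/
theorem GroundStateRigidity_proofCutLine : GroundStateRigidity :=
  GroundStateRigidity_of

/-- The same composition read against the verbatim-shared decl of route `BECRieszReverseHolder`.
[cite: ReedSimonIV1978, §XIII.12] -/
theorem GroundStateRigidity_proofRieszReverseHolder :
    Summit.AtomisticToContinuum.BoseEinsteinCondensation.Theses.BECRieszReverseHolder.GroundStateRigidity :=
  GroundStateRigidity_of

end Summit.AtomisticToContinuum.BoseEinsteinCondensation.Cruxes.GroundStateRigidity.ZooReduction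

end
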